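import Mathlib
import Summits.Ventures.PercRepro2.TypedSeparatedAll

/-!
# The equality locus on the separated class (blind cell PercRepro2, night-3 g5, 2026-08-25;
`proofs/NIGHT3-CERT.md` §14.10)

On a separated instance (`a₁ ↮ a₂` in `z ∪ F`) a NONZERO typed base forces the placement
«`o` and `b` on the side of one root, `a₃` on the side of the other»
(`placement_of_typedCount_ne_zero`): every other placement vanishes by `TypedSeparatedZero.lean`
and the cross files.  Together with the four-mark theorem of `TypedUntouchedMarks.lean` this
describes the nonzero typed bases of the separated class exactly: they are the instances with
`o, b ∈ C_{z∪F}(a_i)`, `a₃ ∈ C_{z∪F}(a_j)` (`{i, j} = {1, 2}`) whose `a₃`-side difference count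
`A_H` and `l`-side Harris slack `S_same − S_cross` are both positive (`typedCount_eq_sep`).
-/

namespace Summit.Ventures.PercRepro2

open UnionCluster

namespace CovForm

namespace Separated

open OneTyped TypedA3 Untouched TypedFactor SwapRoots

section Main

open Classical

variable {V : Type*} {E : Type*} [Fintype E] [DecidableEq E] {R : Type*} [Field R]
  [LinearOrder R] [IsStrictOrderedRing R]
variable (ends : E → Sym2 V) (o a₁ a₂ a₃ b : V)

/-- On a separated instance with `o` on the `l`-side, a nonzero typed base needs `b` on the
`l`-side and `a₃` on the `h`-side. -/
lemma placement_of_ne_zero_Lo (F : Finset E) (z : Config E) (τ : E → ℕ)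
    (hτ : ∀ e ∈ F, τ e = 1 ∨ τ e = 2) (hsep : Sep ends a₁ a₂ F z)
    (hne : typedCount F z τ (K3 ends o a₁ a₂ a₃ b : Config E → Config E → Config E → R) ≠ 0)
    (hLo : Conn ends (zF F z) a₁ o) :
    Conn ends (zF F z) a₁ b ∧ Conn ends (zF F z) a₂ a₃ := by
  by_cases hLb : Conn ends (zF F z) a₁ b
  · refine ⟨hLb, ?_⟩
    by_contra h3
    exact hne (typedCount_eq_zero_of_sep_a3_offH ends o a₁ a₂ a₃ b F z τ hτ hsep hLo hLb h3)
  · exfalso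
    by_cases hHb : Conn ends (zF F z) a₂ b
    · by_cases h3h : Conn ends (zF F z) a₂ a₃
      · exact hne (typedCount_eq_zero_of_sepStA ends o a₁ a₂ a₃ b F z τ hτ hsep hLo hHb h3h)
      · by_cases h3l : Conn ends (zF F z) a₁ a₃
        · exact hne (typedCount_eq_zero_of_sepStB ends o a₁ a₂ a₃ b F z τ hτ hsep hLo hHb h3l)
        · exact hne (typedCount_eq_zero_of_sepStC ends o a₁ a₂ a₃ b F z τ hτ hsep hLo hHb h3l h3h)
    · exact hne (typedCount_eq_zero_of_bFree ends o a₁ a₂ a₃ b F z τ hτ hLb hHb)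

/-- **The placement of a nonzero typed base on the separated class**: `o` and `b` lie on the side
of one root and `a₃` on the side of the other. -/
theorem placement_of_typedCount_ne_zero (F : Finset E) (z : Config E) (τ : E → ℕ)
    (hτ : ∀ e ∈ F, τ e = 1 ∨ τ e = 2) (hsep : Sep ends a₁ a₂ F z)
    (hne : typedCount F z τ (K3 ends o a₁ a₂ a₃ b : Config E → Config E → Config E → R) ≠ 0) :
    (Conn ends (zF F z) a₁ o ∧ Conn ends (zF F z) a₁ b ∧ Conn ends (zF F z) a₂ a₃) ∨
      (Conn ends (zF F z) a₂ o ∧ Conn ends (zF F z) a₂ b ∧ Conn ends (zF F z) a₁ a₃) := by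
  by_cases hLo : Conn ends (zF F z) a₁ o
  · exact Or.inl ⟨hLo, placement_of_ne_zero_Lo ends o a₁ a₂ a₃ b F z τ hτ hsep hne hLo⟩
  · by_cases hHo : Conn ends (zF F z) a₂ o
    · have hsep' : Sep ends a₂ a₁ F z := fun h => hsep (conn_symm h)
      have hne' : typedCount F z τ
          (K3 ends o a₂ a₁ a₃ b : Config E → Config E → Config E → R) ≠ 0 := by
        rw [typedCount_swap_roots ends o a₁ a₂ a₃ b F z τ]; exact hne
      exact Or.inr ⟨hHo, placement_of_ne_zero_Lo ends o a₂ a₁ a₃ b F z τ hτ hsep' hne' hHo⟩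
    · exact absurd (typedCount_eq_zero_of_oFree ends o a₁ a₂ a₃ b F z τ hτ hLo hHo) hne

end Main

end Separated

end CovForm

end Summit.Ventures.PercRepro2
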